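import Mathlib
import HarnessLib
import Summits.AtomisticToContinuum.Crystallization.Theorems.HolmgrenBoyleLindHalfSpaceUniqueContinuationLayerEmpty
import Summits.AtomisticToContinuum.Crystallization.Theorems.HolmgrenBoyleLindHalfSpaceUniqueContinuationInterfaceObservers
import Summits.AtomisticToContinuum.Crystallization.Theorems.HolmgrenBoyleLindHalfSpaceUniqueContinuationRungsOfCores

/-!
# Route `HolmgrenBoyleLind`: Lennard-Jones force fields of separated sources, part 17b —
INTERFACE RIGIDITY II: vanishing fibres empty the source; total irrationality

Support file for the crux item stmt-AtomisticToContinuum-6075 (`HalfSpaceUniqueContinuation`, line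
`registered`, layered core; written by lead c3). Continues part 17a:

* `hbl_invariant_of_span` — invariance under two periods gives invariance under their `ℤ`-span;
* `hbl_echar_add_freq`, **`hbl_echar_injective_of_irrational`** — if no non-zero horizontal vector
  pairs integrally with `s`, `t` and `γ` (TOTAL IRRATIONALITY of the stacking registry), the
  registry step character `k ↦ e_k(P γ)` of the lattice spanned by `s, t` is injective;
* **`hbl_signedSource_empty_of_fibres`** — vanishing height fibres of all signed structure factors
  empty the source (part 11b layer by layer);
* **`hbl_signedSource_empty_of_arith_observers'`** (+ registered `∀`-form
  `hbl_signedSource_empty_of_arith_observers`) — arithmetic observers with injective registry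
  character empty a signed lattice-invariant source (part 17a + the previous item).
All `[folklore]`; nothing here closes an item.
-/

noncomputable section

namespace Summit.AtomisticToContinuum.Crystallization.Theorems.HolmgrenBoyleLind

open scoped BigOperators Topology InnerProductSpace RealInnerProductSpace FourierTransform
open MeasureTheory Filter Set Literature.Algebra.EuclideanLattices.LatticePeriodic
  Literature.Analysis.SpecialFunctions
open scoped Classical

/-! ## Lattice bookkeeping for the pair form -/

section LatticeFromPeriods

variable {u : EuclideanSpace ℝ (Fin 3)}

/-- Invariance under two horizontal periods propagates to their `ℤ`-span. [folklore] -/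
theorem hbl_invariant_of_span {ι : Type*} (v : ι → (ℝ ∙ u)ᗮ) {S : Set (EuclideanSpace ℝ (Fin 3))}
    (hv : ∀ i, ∀ y : EuclideanSpace ℝ (Fin 3),
      y + ((v i : (ℝ ∙ u)ᗮ) : EuclideanSpace ℝ (Fin 3)) ∈ S ↔ y ∈ S)
    {ℓ : (ℝ ∙ u)ᗮ} (hℓ : ℓ ∈ Submodule.span ℤ (Set.range v)) :
    ∀ y : EuclideanSpace ℝ (Fin 3), y + (ℓ : EuclideanSpace ℝ (Fin 3)) ∈ S ↔ y ∈ S := by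
  induction hℓ using Submodule.span_induction with
  | mem x hx =>
    obtain ⟨i, rfl⟩ := hx
    exact hv i
  | zero => intro y; simp
  | add x z _ _ hx hz =>
    intro y
    rw [Submodule.coe_add, ← add_assoc, hz, hx]
  | smul n x _ hx =>
    intro y
    obtain ⟨m, hm | hm⟩ := Int.eq_nat_or_neg n
    · rw [hm, Submodule.coe_smul_of_tower, natCast_zsmul, ← Nat.cast_smul_eq_nsmul ℝ]
      exact hbl_period_nsmul hx m y
    · rw [hm, Submodule.coe_smul_of_tower, neg_smul, natCast_zsmul, ← Nat.cast_smul_eq_nsmul ℝ]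
      exact hbl_period_neg (hbl_period_nsmul hx m) y

/-- Additivity of the characters in the frequency. [folklore] -/
theorem hbl_echar_add_freq (Λ : Submodule ℤ (ℝ ∙ u)ᗮ) [DiscreteTopology Λ] [IsZLattice ℝ Λ]
    (k k' : Fin (Module.finrank ℝ (ℝ ∙ u)ᗮ) → ℤ) (x : (ℝ ∙ u)ᗮ) :
    echar Λ (k + k') x = echar Λ k x * echar Λ k' x := by
  rw [echar_eq_cexp_inner_dualVec, echar_eq_cexp_inner_dualVec, echar_eq_cexp_inner_dualVec,
    dualVec_add, inner_add_left, Complex.ofReal_add, mul_add, Complex.exp_add]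

/-- **Injectivity of the registry character from total irrationality.** If no non-zero vector
of the plane pairing integrally with the periods `s, t` pairs integrally with `γ`, then
`k ↦ e_k(P γ)` is injective. [folklore] -/
theorem hbl_echar_injective_of_irrational (Λ : Submodule ℤ (ℝ ∙ u)ᗮ) [DiscreteTopology Λ]
    [IsZLattice ℝ Λ] {s t γ : EuclideanSpace ℝ (Fin 3)}
    (hs : ∃ s' : Λ, ((s' : (ℝ ∙ u)ᗮ) : EuclideanSpace ℝ (Fin 3)) = s)
    (ht : ∃ t' : Λ, ((t' : (ℝ ∙ u)ᗮ) : EuclideanSpace ℝ (Fin 3)) = t)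
    (hirr : ∀ w : EuclideanSpace ℝ (Fin 3), ⟪w, u⟫ = 0 → (∃ m : ℤ, ⟪w, s⟫ = m) →
      (∃ m : ℤ, ⟪w, t⟫ = m) → (∃ m : ℤ, ⟪w, γ⟫ = m) → w = 0) :
    Function.Injective fun k : Fin (Module.finrank ℝ (ℝ ∙ u)ᗮ) → ℤ =>
      echar Λ k ((ℝ ∙ u)ᗮ.orthogonalProjectionOnto γ) := by
  intro k k' hkk'
  simp only at hkk'
  -- `e_{k - k'}(P γ) = 1`
  have hne : echar Λ k' ((ℝ ∙ u)ᗮ.orthogonalProjectionOnto γ) ≠ 0 := by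
    rw [← norm_pos_iff, norm_echar]; exact one_pos
  have hone : echar Λ (k - k') ((ℝ ∙ u)ᗮ.orthogonalProjectionOnto γ) = 1 := by
    have h := hbl_echar_add_freq Λ (k - k') k' ((ℝ ∙ u)ᗮ.orthogonalProjectionOnto γ)
    rw [sub_add_cancel, hkk'] at h
    exact (mul_eq_right₀ hne).1 h.symm
  rw [echar_eq_cexp_inner_dualVec, Complex.exp_eq_one_iff] at hone
  obtain ⟨n, hn⟩ := hone
  set w : (ℝ ∙ u)ᗮ := dualVec Λ (k - k') with hw
  -- `⟪w, γ⟫ = n`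
  have hwγ : ⟪(w : EuclideanSpace ℝ (Fin 3)), γ⟫ = n := by
    have hI : (2 * Real.pi * Complex.I : ℂ) ≠ 0 := by simp [Real.pi_ne_zero, Complex.I_ne_zero]
    have h1 : ((⟪w, (ℝ ∙ u)ᗮ.orthogonalProjectionOnto γ⟫ : ℝ) : ℂ) = (n : ℂ) := by
      have := hn
      have h2 : (2 * Real.pi * Complex.I : ℂ) * (⟪w, (ℝ ∙ u)ᗮ.orthogonalProjectionOnto γ⟫ : ℝ) =
          (2 * Real.pi * Complex.I : ℂ) * (n : ℂ) := by
        rw [this]; ring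
      exact mul_left_cancel₀ hI h2
    have h3 : ⟪w, (ℝ ∙ u)ᗮ.orthogonalProjectionOnto γ⟫ = n := by exact_mod_cast h1
    rw [Submodule.coe_inner, Submodule.orthogonalProjectionOnto_orthogonal] at h3
    rw [← h3]
    rw [inner_sub_right, Submodule.starProjection_singleton, real_inner_smul_right,
      Submodule.mem_orthogonal_singleton_iff_inner_left.1 w.2]
    ring
  have hwu : ⟪(w : EuclideanSpace ℝ (Fin 3)), u⟫ = 0 :=
    Submodule.mem_orthogonal_singleton_iff_inner_left.1 w.2
  obtain ⟨s', hs'⟩ := hs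
  obtain ⟨t', ht'⟩ := ht
  have hws : ∃ m : ℤ, ⟪(w : EuclideanSpace ℝ (Fin 3)), s⟫ = m := by
    obtain ⟨m, hm⟩ := inner_dualVec_of_mem Λ (k - k') (s' : Λ).2
    exact ⟨m, by rw [← hs', ← Submodule.coe_inner, hw]; exact hm⟩
  have hwt : ∃ m : ℤ, ⟪(w : EuclideanSpace ℝ (Fin 3)), t⟫ = m := by
    obtain ⟨m, hm⟩ := inner_dualVec_of_mem Λ (k - k') (t' : Λ).2
    exact ⟨m, by rw [← ht', ← Submodule.coe_inner, hw]; exact hm⟩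
  have hw0 : (w : EuclideanSpace ℝ (Fin 3)) = 0 := hirr _ hwu hws hwt ⟨n, hwγ⟩
  have hw0' : w = 0 := by exact_mod_cast hw0
  have hkk : k - k' = 0 := dualVec_injective Λ (by rw [← hw, hw0', hbl_dualVec_zero])
  exact sub_eq_zero.1 hkk

end LatticeFromPeriods

section Empty

variable {u : EuclideanSpace ℝ (Fin 3)} (hu : ‖u‖ = 1) (Λ : Submodule ℤ (ℝ ∙ u)ᗮ)
  [DiscreteTopology Λ] [IsZLattice ℝ Λ] {Dp Dm : Set (EuclideanSpace ℝ (Fin 3))} {δ a : ℝ}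
  (hδ : 0 < δ) (hdisj : Disjoint Dp Dm)
  (hsepp : ∀ x ∈ Dp, ∀ y ∈ Dp, x ≠ y → δ ≤ dist x y)
  (hsepm : ∀ x ∈ Dm, ∀ y ∈ Dm, x ≠ y → δ ≤ dist x y)
  (hap : ∀ y ∈ Dp, a ≤ ⟪y, u⟫) (ham : ∀ y ∈ Dm, a ≤ ⟪y, u⟫)
  (hDp : ∀ ℓ : Λ, ∀ y : EuclideanSpace ℝ (Fin 3),
    y + ((ℓ : (ℝ ∙ u)ᗮ) : EuclideanSpace ℝ (Fin 3)) ∈ Dp ↔ y ∈ Dp)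
  (hDm : ∀ ℓ : Λ, ∀ y : EuclideanSpace ℝ (Fin 3),
    y + ((ℓ : (ℝ ∙ u)ᗮ) : EuclideanSpace ℝ (Fin 3)) ∈ Dm ↔ y ∈ Dm)

include hu hδ hdisj hsepp hsepm hap ham hDp hDm in
/-- **Vanishing fibres empty a signed lattice-invariant source.** If every height fibre `T` of the
representatives of `Dp ∪ Dm` has vanishing signed structure factors
`∑_{q ∈ T} ε_q e_{−k}(P q) = 0` for every frequency `k`, then `Dp = Dm = ∅`
(`hbl_signedLayer_empty_of_structureFactors'`, part 11b, layer by layer). [folklore] -/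
theorem hbl_signedSource_empty_of_fibres
    (key : ∀ (k : Fin (Module.finrank ℝ (ℝ ∙ u)ᗮ) → ℤ) (η : ℝ)
      (T : Finset {q : EuclideanSpace ℝ (Fin 3) //
        q ∈ Dp ∪ Dm ∧ (ℝ ∙ u)ᗮ.orthogonalProjectionOnto q ∈ fdom Λ}),
      (∀ q, q ∈ T ↔ ⟪(q : EuclideanSpace ℝ (Fin 3)), u⟫ = η) →
      ∑ q ∈ T, (if ((q : EuclideanSpace ℝ (Fin 3)) ∈ Dp) then (1 : ℂ) else -1) *
        echar Λ (-k) ((ℝ ∙ u)ᗮ.orthogonalProjectionOnto (q : EuclideanSpace ℝ (Fin 3))) = 0) :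
    Dp = ∅ ∧ Dm = ∅ := by
  classical
  have hlayer : ∀ η : ℝ, (∀ y ∈ Dp, ⟪y, u⟫ ≠ η) ∧ (∀ y ∈ Dm, ⟪y, u⟫ ≠ η) := by
    intro η
    refine hbl_signedLayer_empty_of_structureFactors' hu Λ hδ hdisj hsepp hsepm hap ham hDp hDm η
      fun k => ?_
    set Ap := (hbl_reps_height_finite hu Λ hδ hsepp hap η).toFinset.filter
      (fun q : EuclideanSpace ℝ (Fin 3) => ⟪q, u⟫ = η) with hAp
    set Am := (hbl_reps_height_finite hu Λ hδ hsepm ham η).toFinset.filter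
      (fun q : EuclideanSpace ℝ (Fin 3) => ⟪q, u⟫ = η) with hAm
    have hApm : ∀ q, q ∈ Ap → q ∈ Dp ∧ (ℝ ∙ u)ᗮ.orthogonalProjectionOnto q ∈ fdom Λ ∧ ⟪q, u⟫ = η := by
      intro q hq
      rw [hAp, Finset.mem_filter, Set.Finite.mem_toFinset] at hq
      exact ⟨hq.1.1.1, hq.1.1.2, hq.2⟩
    have hAmm : ∀ q, q ∈ Am → q ∈ Dm ∧ (ℝ ∙ u)ᗮ.orthogonalProjectionOnto q ∈ fdom Λ ∧ ⟪q, u⟫ = η := by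
      intro q hq
      rw [hAm, Finset.mem_filter, Set.Finite.mem_toFinset] at hq
      exact ⟨hq.1.1.1, hq.1.1.2, hq.2⟩
    have hdisjA : Disjoint Ap Am :=
      Finset.disjoint_left.2 fun q hp hm =>
        Set.disjoint_left.1 hdisj (hApm q hp).1 (hAmm q hm).1
    -- the fibre of the representatives of `Dp ∪ Dm` at height `η`, as a Finset of the index type
    set T : Finset {q : EuclideanSpace ℝ (Fin 3) //
        q ∈ Dp ∪ Dm ∧ (ℝ ∙ u)ᗮ.orthogonalProjectionOnto q ∈ fdom Λ} :=
      (Ap ∪ Am).subtype (fun q => q ∈ Dp ∪ Dm ∧ (ℝ ∙ u)ᗮ.orthogonalProjectionOnto q ∈ fdom Λ)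
      with hT
    have hmemT : ∀ q : {q : EuclideanSpace ℝ (Fin 3) //
        q ∈ Dp ∪ Dm ∧ (ℝ ∙ u)ᗮ.orthogonalProjectionOnto q ∈ fdom Λ},
        q ∈ T ↔ ⟪(q : EuclideanSpace ℝ (Fin 3)), u⟫ = η := by
      intro q
      rw [hT, Finset.mem_subtype, Finset.mem_union]
      constructor
      · rintro (h | h)
        · exact (hApm _ h).2.2
        · exact (hAmm _ h).2.2
      · intro h
        rcases q.2.1 with hq | hq
        · refine Or.inl ?_
          rw [hAp, Finset.mem_filter, Set.Finite.mem_toFinset]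
          exact ⟨⟨⟨hq, q.2.2⟩, h.le⟩, h⟩
        · refine Or.inr ?_
          rw [hAm, Finset.mem_filter, Set.Finite.mem_toFinset]
          exact ⟨⟨⟨hq, q.2.2⟩, h.le⟩, h⟩
    have hsum := key k η T hmemT
    -- rewrite the sum over `T` as the signed sum over `Ap ∪ Am`
    have hsub : ∑ q ∈ T, (if ((q : EuclideanSpace ℝ (Fin 3)) ∈ Dp) then (1 : ℂ) else -1) *
          echar Λ (-k) ((ℝ ∙ u)ᗮ.orthogonalProjectionOnto (q : EuclideanSpace ℝ (Fin 3))) =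
        ∑ q ∈ Ap ∪ Am, (if q ∈ Dp then (1 : ℂ) else -1) *
          echar Λ (-k) ((ℝ ∙ u)ᗮ.orthogonalProjectionOnto q) := by
      rw [hT, Finset.sum_subtype_eq_sum_filter (f := fun q : EuclideanSpace ℝ (Fin 3) =>
        (if q ∈ Dp then (1 : ℂ) else -1) * echar Λ (-k) ((ℝ ∙ u)ᗮ.orthogonalProjectionOnto q))]
      refine Finset.sum_congr (Finset.filter_true_of_mem fun q hq => ?_) fun _ _ => rfl
      rcases Finset.mem_union.1 hq with h | h
      · exact ⟨Or.inl (hApm q h).1, (hApm q h).2.1⟩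
      · exact ⟨Or.inr (hAmm q h).1, (hAmm q h).2.1⟩
    rw [hsub, Finset.sum_union hdisjA] at hsum
    have h1 : ∑ q ∈ Ap, (if q ∈ Dp then (1 : ℂ) else -1) *
          echar Λ (-k) ((ℝ ∙ u)ᗮ.orthogonalProjectionOnto q) =
        ∑ q ∈ Ap, echar Λ (-k) ((ℝ ∙ u)ᗮ.orthogonalProjectionOnto q) :=
      Finset.sum_congr rfl fun q hq => by rw [if_pos (hApm q hq).1, one_mul]
    have h2 : ∑ q ∈ Am, (if q ∈ Dp then (1 : ℂ) else -1) *
          echar Λ (-k) ((ℝ ∙ u)ᗮ.orthogonalProjectionOnto q) =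
        -∑ q ∈ Am, echar Λ (-k) ((ℝ ∙ u)ᗮ.orthogonalProjectionOnto q) := by
      rw [← Finset.sum_neg_distrib]
      refine Finset.sum_congr rfl fun q hq => ?_
      rw [if_neg (Set.disjoint_right.1 hdisj (hAmm q hq).1), neg_one_mul]
    rw [h1, h2, ← sub_eq_add_neg, sub_eq_zero] at hsum
    exact hsum
  constructor
  · exact Set.eq_empty_of_forall_notMem fun y hy => (hlayer ⟪y, u⟫).1 y hy rfl
  · exact Set.eq_empty_of_forall_notMem fun y hy => (hlayer ⟪y, u⟫).2 y hy rfl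

include hu hδ hdisj hsepp hsepm hap ham hDp hDm in
/-- **Arithmetic observers empty a signed lattice-invariant source.** Under the hypotheses of
`hbl_fibres_eq_zero_of_arith_observers'`, both signs of the source are empty
(`hbl_signedSource_empty_of_fibres`). [folklore] -/
theorem hbl_signedSource_empty_of_arith_observers' (x₀ γ : EuclideanSpace ℝ (Fin 3))
    (hx₀ : ⟪x₀, u⟫ < a) (hγ : ⟪γ, u⟫ < 0)
    (hinj : Function.Injective fun k : Fin (Module.finrank ℝ (ℝ ∙ u)ᗮ) → ℤ =>
      echar Λ k ((ℝ ∙ u)ᗮ.orthogonalProjectionOnto γ))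
    (hobs : ∀ n : ℕ,
      (∑' yy : ↥(Dp ∪ Dm), (if (yy : EuclideanSpace ℝ (Fin 3)) ∈ Dp then (1 : ℂ) else -1) *
        ((⟪u, ((((‖(x₀ + (n : ℝ) • γ) - (yy : EuclideanSpace ℝ (Fin 3))‖ ^ 2) ^ 4)⁻¹ -
            ((‖(x₀ + (n : ℝ) • γ) - (yy : EuclideanSpace ℝ (Fin 3))‖ ^ 2) ^ 7)⁻¹) •
              ((x₀ + (n : ℝ) • γ) - (yy : EuclideanSpace ℝ (Fin 3))))⟫ : ℝ) : ℂ)) = 0) :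
    Dp = ∅ ∧ Dm = ∅ :=
  hbl_signedSource_empty_of_fibres hu Λ hδ hdisj hsepp hsepm hap ham hDp hDm
    (hbl_fibres_eq_zero_of_arith_observers' hu Λ hδ hsepp hsepm hap ham hDp hDm x₀ γ hx₀ hγ hinj
      hobs)

end Empty

/-- **Arithmetic observers empty a signed lattice-invariant source** (registered `∀`-form of
`hbl_signedSource_empty_of_arith_observers'`). [folklore] -/
theorem hbl_signedSource_empty_of_arith_observers : ∀ {u : EuclideanSpace ℝ (Fin 3)} (hu : ‖u‖ = 1) (Λ : Submodule ℤ (ℝ ∙ u)ᗮ) [DiscreteTopology Λ] [IsZLattice ℝ Λ] {Dp Dm : Set (EuclideanSpace ℝ (Fin 3))} {δ a : ℝ} (hδ : 0 < δ), Disjoint Dp Dm → (∀ x ∈ Dp, ∀ y ∈ Dp, x ≠ y → δ ≤ dist x y) → (∀ x ∈ Dm, ∀ y ∈ Dm, x ≠ y → δ ≤ dist x y) → (∀ y ∈ Dp, a ≤ inner ℝ y u) → (∀ y ∈ Dm, a ≤ inner ℝ y u) → (∀ ℓ : Λ, ∀ y : EuclideanSpace ℝ (Fin 3), y + ((ℓ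 : (ℝ ∙ u)ᗮ) : EuclideanSpace ℝ (Fin 3)) ∈ Dp ↔ y ∈ Dp) → (∀ ℓ : Λ, ∀ y : EuclideanSpace ℝ (Fin 3), y + ((ℓ : (ℝ ∙ u)ᗮ) : EuclideanSpace ℝ (Fin 3)) ∈ Dm ↔ y ∈ Dm) → ∀ (x₀ γ : EuclideanSpace ℝ (Fin 3)), inner ℝ x₀ u < a → inner ℝ γ u < 0 → (Function.Injective fun k : Fin (Module.finrank ℝ (ℝ ∙ u)ᗮ) → ℤ => Literature.Algebra.EuclideanLattices.LatticePeriodic.echar Λ k ((ℝ ∙ u)ᗮ.orthogonalProjectionOnto γ)) → (∀ n : ℕ, (∑' yy : ↥(Dp ∪ Dm), (if (yy : EuclideanSpace ℝ (Fin 3)) ∈ Dp then (1 : ℂ) else -1) * ((inner ℝ u (((((‖(x₀ + (n : ℝ) • γ) - (yy : EuclideanSpace ℝ (Fin 3))‖ ^ 2) ^ 4)⁻¹ - ((‖(x₀ + (n : ℝ) • γ) - (yy : EuclideanSpace ℝ (Fin 3))‖ ^ 2) ^ 7)⁻¹) • ((x₀ + (n : ℝ) • γ) - (yy : EuclideanSpace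 ℝ (Fin 3))))) : ℝ) : ℂ)) = 0) → Dp = ∅ ∧ Dm = ∅ := by
  intro u hu Λ _ _ Dp Dm δ a hδ hdisj hsepp hsepm hap ham hDp hDm x₀ γ hx₀ hγ hinj hobs
  exact hbl_signedSource_empty_of_arith_observers' hu Λ hδ hdisj hsepp hsepm hap ham hDp hDm x₀ γ
    hx₀ hγ hinj hobs

end Summit.AtomisticToContinuum.Crystallization.Theorems.HolmgrenBoyleLind

end
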